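/- Copyright: the b2b-balaban cell (near-miss cell 7), T⁴-continuum CRUX team (coordinator ruling e34b3e0c item (2)), row NE7b,
lineage t4-ne7b-formalise-leaf-02 (gen 126; E-side ∕ key-readings lineage) — `KeyPatternBooking` for an ARBITRARY term class (gaps-ne6's
`KeyPatternReadingB.classPattern`) and RUN B's row `pwB` along `keyPatternB`.  Released under the licence of the surrounding project. -/
import Summits.QuantumFields.BalabanUV.T4Continuum.Spine.NE7b.KeyPatternBooking
import Summits.QuantumFields.BalabanUV.T4Continuum.Spine.NE7b.KeyPatternReadingB

/-!
# WHAT A CLASS-PATTERN CHOICE BOOKS, AND RUN B's POINTWISE EXTRACTION ALONG `keyPatternB` (row NE7b, node U5c; E-side bookkeeping for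
# IR-104-2's row `pwB` — the run-B twin of `KeyPatternBooking`)

Crux-route work under `Spine/NE7b/` of the T⁴-continuum cell (rung (B)+1 on a FINITE torus only; NOT infinite volume, NOT the mass gap,
NOT Clay; NOT a proof of NE7b — `T4WeightBudget.RelWeightBound`, the cell's OWN estimate, NOT PRINTED, NOT PROVED).  [folklore] finite
combinatorics and one finite-sum inequality over the TREE's own objects: gaps-ne6 g9's `KeyPatternReadingB.classPattern ∕ filterB ∕
keyPatternB` (p359906), this lineage's `KeyPatternBooking` (J2a's prefix ∕ causality lemmas `N_runPartial_take`, …, `sum_inter_le_one`), the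
causal step reading and `LocalConditionalStability.chebyshev_extraction ∕ PointwiseExtraction`.  No `def`, no `structure`, no `[cite:]` tag,
nothing of Bałaban's; zero `sorry`.

WHY.  `KeyPatternBooking` types J2a and inhabits IR-104-2's run-A row `pwA` along IR-104-1's `keyPattern … K k = classPattern … K (fibre … K k)`
(`KeyPatternReadingB.keyPattern_eq_classPattern`, `rfl`).  Run B's row `pwB` lives along `keyPatternB … trunc K k := classPattern … (K + 1)
(filterB … K k)` — the class pattern of the cutoff-`(K+1)` terms TRUNCATING into the fibre of `k`.  The J2a argument never used that the
class is a fibre: a class-pattern choice `p` after `g` at step `j` is a step of SOME history whose term lies in the class, whose run books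
`𝒮.ν K j g p` at level `j + 1`; so everything holds for an ARBITRARY term class `Φ`, and run B is the instance `Φ := filterB`, cutoff `K + 1`.

WHAT.  §1 `exists_mem_history_of_mem_classPattern`, **`exists_mem_run_of_mem_classPattern`** (J2a RUN FORM for a class: some `τ ∈ Φ` books
`𝒮.ν K j g p` at level `j + 1` and its `N ∕ F ∕ StM ∕ histM.comp ∕ histM.constit ∕ rnwM` up to level `j + 1` (`F`, `rnwM`: `≤ j`) are those
of `𝒮.runPartial K (j + 1) (snoc g p)`).  §2 J2a BOOKED FORM for a class: **`subset_ν_of_forall_class`**, **`subset_image_ν_of_forall_class`**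
(a region ∕ value family realised at level `j + 1` by EVERY term of `Φ` is named by every class-pattern choice at step `j`).  §3
**`pointwiseExtraction_classPattern_of_reading`** (from (d1) `Σ_{pinned} χ ≤ 1`, (d2) the field-support reading through a value map `v`,
(d3) `R (j + 1)` realised by every term of `Φ`: `PointwiseExtraction (T K) (classPattern T p₀ K Φ) K χ (fun j _ y => exp (δ·Σ_{w ∈ R (j+1)}
F j w y)) (fun j _ => δ·Σ_{w ∈ R (j+1)} θ j w)`), `…_of_unit`, and WITH MULTIPLICITY **`…_of_readingM`** (`R (j + 1)` a MULTISET of values —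
the per-member currency of a ledger — only its support displayed as realised), and for the twin row: **`locCondStability_of_booking_levels`**
(∕ `'`): `LocCondStability` for the booked carrier `exp (δ·Σ_{R (j+1)} F)` is OWED AT THE BOOKING LEVELS ONLY — where `R (j + 1)` is empty the
carrier is `1` and the row is the term's bare integrability with any `b ≥ 0`; §4 RUN B:
**`pointwiseExtraction_keyPatternB_of_reading`** ∕ `…_of_unit` ∕ `…_of_readingM` — IR-104-2's `pwB : PointwiseExtraction (T (K + 1))
(keyPatternB T p₀ (kmemA …) trunc K k) (K + 1) (χ (K + 1)) (MB K k t) (fun j _ => aB K k j)` INHABITED IN SHAPE from (d1), (d2) on the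
cutoff-`(K+1)` tower's kernel and (d3B) «`R (j + 1)` is realised at level `j + 1` by every cutoff-`(K+1)` term truncating into the fibre
of `k`» — a DISPLAY for run B (the record's `trunc` is abstract data with `htr ∕ htr0` only:
which regions a `(K+1)`-history books is NOT read off the key of its truncation — the «TRUNC» reading, (S)∕(A1c)'s; contrast run A, where
`KeyBirthsBooked` discharges (d3) for `kmemA` by pass V).

HONEST.  Bookkeeping on OUR carriers; (d1) ∕ (d2) ∕ (d3B), `lcsB` DISPLAYED ∕ OWED; BY-NAME EFFECT ON THE WALL: NONE.  NE7b NOT PRINTED ∕ NOT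
PROVED; spine PROVED 0∕9.  HONEST DEPENDENCY (cell): continuum YM on T⁴ ⇐ BetaPertH ∧ nine spine estimates (0/9 proved); BetaPertH ⇐ (D1) ∧
(D4) ∧ CAP+tail; G-an2-4 gates asym, D1 and NE2/3/4.  This file changes none of it.
-/

set_option autoImplicit false

open Finset Real MeasureTheory
open Literature.MathematicalPhysics.QuantumFieldTheory.Balaban1983to89
open Literature.MathematicalPhysics.QuantumFieldTheory.Balaban1983to89.T4LiveClassFibration
open Literature.MathematicalPhysics.QuantumFieldTheory.Balaban1983to89.B13ScaleTransfer
open Summit.QuantumFields.BalabanUV.T4Continuum.HistoryGenealogyRealise (Lab)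
open Summit.QuantumFields.BalabanUV.T4Continuum.HistoryGenealogyInstantiate
open Summit.QuantumFields.BalabanUV.T4Continuum.B16HistoryIndexedRepr
open Summit.QuantumFields.BalabanUV.T4Continuum.B16HistoryReprChain
open Summit.QuantumFields.BalabanUV.T4Continuum.B16HistoryReprInstance
open Summit.QuantumFields.BalabanUV.T4Continuum.B16HistoryReprReadCausal
open Summit.QuantumFields.BalabanUV.T4Continuum.NE7b.PrefixExtraction
open Summit.QuantumFields.BalabanUV.T4Continuum.NE7b.PrefixExtractionLaws
open Summit.QuantumFields.BalabanUV.T4Continuum.NE7b.LocalConditionalStability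
open Summit.QuantumFields.BalabanUV.T4Continuum.NE7b.KeyPatternReading
open Summit.QuantumFields.BalabanUV.T4Continuum.NE7b.KeyPatternReadingB
open Summit.QuantumFields.BalabanUV.T4Continuum.NE7b.KeyPatternBooking

namespace Summit.QuantumFields.BalabanUV.T4Continuum.NE7b.ClassPatternBooking

noncomputable section

/-! ## §1 J2a, run form, for an arbitrary term class -/

section RunForm

variable {P : Type} [DecidableEq P] {d : ℕ} (𝒮 : StepReading P d) {C : ℕ → ℕ → Type} {𝒢 : (K j : ℕ) → GoodClass (C K j)}
  (T : (K : ℕ) → Tower P (C K) (𝒢 K)) (p₀ : ℕ → ℕ → P)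

/-- **A CLASS-PATTERN CHOICE IS A STEP OF A HISTORY WHOSE TERM LIES IN THE CLASS**: prefix `g`, step `p`. [folklore] -/
theorem exists_mem_history_of_mem_classPattern {K : ℕ} {Φ : Finset (HIndex.Idx (skelFam T p₀))} {j : ℕ} {g : Fin j → P} {p : P}
    (hp : p ∈ classPattern T p₀ K Φ j g) :
    ∃ (h : Fin K → P) (hj : j < K), histIdx T p₀ K h ∈ Φ ∧
      Fin.take j (Nat.le_of_lt hj) h = g ∧ h ⟨j, hj⟩ = p ∧ Fin.take (j + 1) hj h = Fin.snoc g p := by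
  obtain ⟨-, h, hj, hΦ, htake⟩ := (mem_classPattern T p₀).1 hp
  refine ⟨h, hj, hΦ, ?_, ?_, htake⟩
  · have e := congrArg Fin.init htake
    rw [Fin.take_succ_eq_snoc] at e
    simpa only [Fin.init_snoc] using e
  · have e := congrFun htake (Fin.last j)
    rw [Fin.take_succ_eq_snoc] at e
    simpa only [Fin.snoc_last] using e

/-- **J2a, RUN FORM, FOR A TERM CLASS.**  If `p` is a class-pattern choice of the class `Φ` after the prefix `g` at step `j` of run `K`,
then SOME TERM `τ ∈ Φ` PASSES THROUGH `snoc g p`: its run under the causal reading books at level `j + 1` exactly the regions `𝒮.ν K j g p`,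
and the process read off `snoc g p` IS its process up to level `j + 1` (new regions, process state, components, constituent lists at the
levels `≤ j + 1`; new fields and renewal flags at the levels `≤ j`). [folklore] -/
theorem exists_mem_run_of_mem_classPattern {K : ℕ} {Φ : Finset (HIndex.Idx (skelFam T p₀))} {j : ℕ} {g : Fin j → P} {p : P}
    (hp : p ∈ classPattern T p₀ K Φ j g) :
    ∃ τ ∈ Φ,
      ((𝒮.reading T p₀).inputOf.run K τ).N (j + 1) = 𝒮.ν K j g p ∧
      (∀ ℓ, ℓ ≤ j + 1 → (𝒮.runPartial K (j + 1) (Fin.snoc g p)).N ℓ = ((𝒮.reading T p₀).inputOf.run K τ).N ℓ) ∧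
      (∀ ℓ, ℓ ≤ j → (𝒮.runPartial K (j + 1) (Fin.snoc g p)).F ℓ = ((𝒮.reading T p₀).inputOf.run K τ).F ℓ) ∧
      (∀ ℓ, ℓ ≤ j + 1 → (𝒮.runPartial K (j + 1) (Fin.snoc g p)).StM ℓ = ((𝒮.reading T p₀).inputOf.run K τ).StM ℓ) ∧
      (∀ ℓ, ℓ ≤ j + 1 →
        (𝒮.runPartial K (j + 1) (Fin.snoc g p)).histM.comp ℓ = ((𝒮.reading T p₀).inputOf.run K τ).histM.comp ℓ) ∧
      (∀ ℓ, ℓ ≤ j + 1 →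
        (𝒮.runPartial K (j + 1) (Fin.snoc g p)).histM.constit ℓ = ((𝒮.reading T p₀).inputOf.run K τ).histM.constit ℓ) ∧
      (∀ ℓ, ℓ ≤ j → (𝒮.runPartial K (j + 1) (Fin.snoc g p)).rnwM ℓ = ((𝒮.reading T p₀).inputOf.run K τ).rnwM ℓ) := by
  obtain ⟨h, hj, hΦ, hg, hpj, htake⟩ := exists_mem_history_of_mem_classPattern T p₀ hp
  refine ⟨histIdx T p₀ K h, hΦ, ?_, ?_, ?_, ?_, ?_, ?_, ?_⟩
  · rw [run_histIdx, N_runPartial_succ 𝒮 K h hj, hg, hpj]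
  · intro ℓ hℓ
    rw [run_histIdx, ← htake]
    exact N_runPartial_take 𝒮 K h hj ℓ hℓ
  · intro ℓ hℓ
    rw [run_histIdx, ← htake]
    exact F_runPartial_take 𝒮 K h hj ℓ (Nat.lt_succ_of_le hℓ)
  · intro ℓ hℓ
    rw [run_histIdx, ← htake]
    exact StM_runPartial_take 𝒮 K h hj hℓ
  · intro ℓ hℓ
    rw [run_histIdx, ← htake]
    exact histM_comp_runPartial_take 𝒮 K h hj hℓ
  · intro ℓ hℓ
    rw [run_histIdx, ← htake]
    exact histM_constit_runPartial_take 𝒮 K h hj hℓ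
  · intro ℓ hℓ
    rw [run_histIdx, ← htake]
    exact rnwM_runPartial_take 𝒮 K h hj (Nat.lt_succ_of_le hℓ)

end RunForm

/-! ## §2 J2a, booked form, for an arbitrary term class -/

section Booked

variable {P : Type} [DecidableEq P] {d : ℕ} (𝒮 : StepReading P d) {C : ℕ → ℕ → Type} {𝒢 : (K j : ℕ) → GoodClass (C K j)}
  (T : (K : ℕ) → Tower P (C K) (𝒢 K)) (p₀ : ℕ → ℕ → P)

/-- **A REGION FAMILY BOOKED AT LEVEL `j + 1` BY EVERY TERM OF THE CLASS IS NAMED BY EVERY CLASS-PATTERN CHOICE AT STEP `j`.** [folklore] -/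
theorem subset_ν_of_forall_class {K : ℕ} {Φ : Finset (HIndex.Idx (skelFam T p₀))} {j : ℕ} {g : Fin j → P} {p : P}
    (hp : p ∈ classPattern T p₀ K Φ j g) {R : Finset (Lab d)}
    (hR : ∀ τ ∈ Φ, R ⊆ ((𝒮.reading T p₀).inputOf.run K τ).N (j + 1)) : R ⊆ 𝒮.ν K j g p := by
  obtain ⟨τ, hτ, hN, -⟩ := exists_mem_run_of_mem_classPattern 𝒮 T p₀ hp
  rw [← hN]
  exact hR τ hτ

/-- **… READ THROUGH A VALUE MAP**: a value family realised at level `j + 1` by every term of the class is realised by the regions every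
class-pattern choice names at step `j`. [folklore] -/
theorem subset_image_ν_of_forall_class {V : Type*} [DecidableEq V] (v : Lab d → V) {K : ℕ} {Φ : Finset (HIndex.Idx (skelFam T p₀))}
    {j : ℕ} {g : Fin j → P} {p : P} (hp : p ∈ classPattern T p₀ K Φ j g) {R : Finset V}
    (hR : ∀ τ ∈ Φ, R ⊆ (((𝒮.reading T p₀).inputOf.run K τ).N (j + 1)).image v) : R ⊆ (𝒮.ν K j g p).image v := by
  obtain ⟨τ, hτ, hN, -⟩ := exists_mem_run_of_mem_classPattern 𝒮 T p₀ hp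
  rw [← hN]
  exact hR τ hτ

end Booked

/-! ## §3 Pointwise extraction along a class pattern from a field-support reading of the step kernel -/

section Extraction

variable {P : Type} [DecidableEq P] {d : ℕ} (𝒮 : StepReading P d) {C : ℕ → ℕ → Type} {𝒢 : (K j : ℕ) → GoodClass (C K j)}
  (T : (K : ℕ) → Tower P (C K) (𝒢 K)) (p₀ : ℕ → ℕ → P)

/-- **POINTWISE EXTRACTION ALONG THE CLASS PATTERN OF `Φ`, THE EXTRACTED SET READ THROUGH A VALUE MAP**: from (d1) `hle1` (the pinned
characteristic functions sum to at most one at every pattern prefix), (d2) `hsupp` (wherever `χ j g p y ≠ 0`, for every region `Z` the choice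
names, `θ j (v (j+1) Z) ≤ F j (v (j+1) Z) y`) and (d3) `hR` (the value family `R (j + 1)` is realised at level `j + 1` by every term of
`Φ`): `PointwiseExtraction (T K) (classPattern T p₀ K Φ) K χ M a` with `a j = δ·Σ_{w ∈ R (j+1)} θ j w`,
`M j y = exp (δ·Σ_{w ∈ R (j+1)} F j w y)` — `chebyshev_extraction` at the one functional the pinned choices share by
`subset_image_ν_of_forall_class`. [folklore] -/
theorem pointwiseExtraction_classPattern_of_reading {V : Type*} [DecidableEq V] (v : ℕ → Lab d → V) (K : ℕ)
    (Φ : Finset (HIndex.Idx (skelFam T p₀))) (χ : (j : ℕ) → (Fin j → P) → P → C K j → ℝ) (F : (j : ℕ) → V → C K j → ℝ)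
    (θ : ℕ → V → ℝ) {δ : ℝ} (hδ : 0 ≤ δ) (R : ℕ → Finset V)
    (hR : ∀ j, j < K → ∀ τ ∈ Φ, R (j + 1) ⊆ (((𝒮.reading T p₀).inputOf.run K τ).N (j + 1)).image (v (j + 1)))
    (hle1 : ∀ j g, j < K → g ∈ admS (T K) (classPattern T p₀ K Φ) j → ∀ y,
      ∑ p ∈ (T K).branch j g ∩ classPattern T p₀ K Φ j g, χ j g p y ≤ 1)
    (hsupp : ∀ j g p, j < K → g ∈ (T K).adm j → p ∈ (T K).branch j g → ∀ y, χ j g p y ≠ 0 →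
      ∀ Z ∈ 𝒮.ν K j g p, θ j (v (j + 1) Z) ≤ F j (v (j + 1) Z) y) :
    PointwiseExtraction (T K) (classPattern T p₀ K Φ) K χ (fun j _ y => exp (δ * ∑ w ∈ R (j + 1), F j w y))
      fun j _ => δ * ∑ w ∈ R (j + 1), θ j w := by
  intro j g hj hg y
  refine chebyshev_extraction ((T K).branch j g ∩ classPattern T p₀ K Φ j g) (fun p => χ j g p)
    (fun y => ∑ w ∈ R (j + 1), F j w y) hδ (hle1 j g hj hg) (fun p hp y' hne => ?_) y
  obtain ⟨hb, hk⟩ := Finset.mem_inter.1 hp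
  have hsub : R (j + 1) ⊆ (𝒮.ν K j g p).image (v (j + 1)) :=
    subset_image_ν_of_forall_class 𝒮 T p₀ (v (j + 1)) hk (hR j hj)
  refine Finset.sum_le_sum fun w hw => ?_
  obtain ⟨Z, hZ, rfl⟩ := Finset.mem_image.1 (hsub hw)
  exact hsupp j g p hj (admS_subset_adm (T K) _ j hg) hb y' hne Z hZ

/-- **… FROM POSITIVITY AND THE DECOMPOSITION OF UNITY** ((d1) from `hχ0` + `hunit` by `KeyPatternBooking.sum_inter_le_one`). [folklore] -/
theorem pointwiseExtraction_classPattern_of_unit {V : Type*} [DecidableEq V] (v : ℕ → Lab d → V) (K : ℕ)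
    (Φ : Finset (HIndex.Idx (skelFam T p₀))) (χ : (j : ℕ) → (Fin j → P) → P → C K j → ℝ) (F : (j : ℕ) → V → C K j → ℝ)
    (θ : ℕ → V → ℝ) {δ : ℝ} (hδ : 0 ≤ δ) (R : ℕ → Finset V)
    (hR : ∀ j, j < K → ∀ τ ∈ Φ, R (j + 1) ⊆ (((𝒮.reading T p₀).inputOf.run K τ).N (j + 1)).image (v (j + 1)))
    (hχ0 : ∀ j g p, j < K → g ∈ (T K).adm j → p ∈ (T K).branch j g → ∀ y, 0 ≤ χ j g p y)
    (hunit : ∀ j g, j < K → g ∈ (T K).adm j → ∀ y, ∑ p ∈ (T K).branch j g, χ j g p y = 1)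
    (hsupp : ∀ j g p, j < K → g ∈ (T K).adm j → p ∈ (T K).branch j g → ∀ y, χ j g p y ≠ 0 →
      ∀ Z ∈ 𝒮.ν K j g p, θ j (v (j + 1) Z) ≤ F j (v (j + 1) Z) y) :
    PointwiseExtraction (T K) (classPattern T p₀ K Φ) K χ (fun j _ y => exp (δ * ∑ w ∈ R (j + 1), F j w y))
      fun j _ => δ * ∑ w ∈ R (j + 1), θ j w :=
  pointwiseExtraction_classPattern_of_reading 𝒮 T p₀ v K Φ χ F θ hδ R hR
    (fun j g hj hg y => sum_inter_le_one _ _ (fun p => χ j g p) y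
      (fun p hp => hχ0 j g p hj (admS_subset_adm (T K) _ j hg) hp y) (hunit j g hj (admS_subset_adm (T K) _ j hg) y))
    hsupp

/-- **THE SAME WITH MULTIPLICITY** (the extracted family as a MULTISET of values — e.g. the key's recorded births counted per member,
the currency of a per-member ledger): only the SUPPORT of `R (j + 1)` has to be realised by every term of `Φ` (`hR`); the exponent
`a j = δ·Σ_{w ∈ R (j+1)} θ j w` and the carrier's functional `Σ_{w ∈ R (j+1)} F j w` are sums WITH multiplicity (`Multiset.map … |>.sum`),
and the support reading (d2) bounds them termwise. [folklore] -/
theorem pointwiseExtraction_classPattern_of_readingM {V : Type*} [DecidableEq V] (v : ℕ → Lab d → V) (K : ℕ)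
    (Φ : Finset (HIndex.Idx (skelFam T p₀))) (χ : (j : ℕ) → (Fin j → P) → P → C K j → ℝ) (F : (j : ℕ) → V → C K j → ℝ)
    (θ : ℕ → V → ℝ) {δ : ℝ} (hδ : 0 ≤ δ) (R : ℕ → Multiset V)
    (hR : ∀ j, j < K → ∀ τ ∈ Φ, ∀ w ∈ R (j + 1), w ∈ (((𝒮.reading T p₀).inputOf.run K τ).N (j + 1)).image (v (j + 1)))
    (hle1 : ∀ j g, j < K → g ∈ admS (T K) (classPattern T p₀ K Φ) j → ∀ y,
      ∑ p ∈ (T K).branch j g ∩ classPattern T p₀ K Φ j g, χ j g p y ≤ 1)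
    (hsupp : ∀ j g p, j < K → g ∈ (T K).adm j → p ∈ (T K).branch j g → ∀ y, χ j g p y ≠ 0 →
      ∀ Z ∈ 𝒮.ν K j g p, θ j (v (j + 1) Z) ≤ F j (v (j + 1) Z) y) :
    PointwiseExtraction (T K) (classPattern T p₀ K Φ) K χ (fun j _ y => exp (δ * ((R (j + 1)).map fun w => F j w y).sum))
      fun j _ => δ * ((R (j + 1)).map (θ j)).sum := by
  intro j g hj hg y
  refine chebyshev_extraction ((T K).branch j g ∩ classPattern T p₀ K Φ j g) (fun p => χ j g p)
    (fun y => ((R (j + 1)).map fun w => F j w y).sum) hδ (hle1 j g hj hg) (fun p hp y' hne => ?_) y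
  obtain ⟨hb, hk⟩ := Finset.mem_inter.1 hp
  have hsub : (R (j + 1)).toFinset ⊆ (𝒮.ν K j g p).image (v (j + 1)) :=
    subset_image_ν_of_forall_class 𝒮 T p₀ (v (j + 1)) hk fun τ hτ w hw => hR j hj τ hτ w (Multiset.mem_toFinset.1 hw)
  refine Multiset.sum_map_le_sum_map _ _ fun w hw => ?_
  obtain ⟨Z, hZ, rfl⟩ := Finset.mem_image.1 (hsub (Multiset.mem_toFinset.2 hw))
  exact hsupp j g p hj (admS_subset_adm (T K) _ j hg) hb y' hne Z hZ

/-- **LOCAL CONDITIONAL STABILITY FOR THE BOOKED CARRIER IS OWED AT THE BOOKING LEVELS ONLY.**  For the carrier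
`M j y = exp (δ·Σ_{w ∈ R (j+1)} F j w y)` of `…_of_readingM` (any pattern `S`): at a level where `R (j + 1)` is empty the carrier is `1`,
so the twin row `LocCondStability` holds there with ANY exponent `b j g ≥ 0` from the bare integrability of the history term (the
records' row `hint`) — `LocalConditionalStability.unpinned_stability`'s content; hence `LocCondStability T S K μ ρ₀ M b` follows from
the pair (integrability ∧ conditional bound) AT THE BOOKING LEVELS (`hbook`) alone.  The (A1c) ∕ Gaussian analyst's list for `lcsA`
is the key's booking levels, not every level. [folklore] -/
theorem locCondStability_of_booking_levels {P : Type} [DecidableEq P] {C : ℕ → Type} {𝒢 : (j : ℕ) → GoodClass (C j)}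
    (T : Tower P C 𝒢) (S : (j : ℕ) → (Fin j → P) → Finset P) (K : ℕ) [∀ j, MeasurableSpace (C j)]
    (μ : (j : ℕ) → Measure (C j)) {ρ₀ : C 0 → ℝ} (hρ : (𝒢 0).Gd ρ₀) (h0 : ∀ x, 0 ≤ ρ₀ x) {V : Type*}
    (R : ℕ → Multiset V) (F : (j : ℕ) → V → C j → ℝ) (δ : ℝ) (b : (j : ℕ) → (Fin j → P) → ℝ)
    (hfree : ∀ j g, j < K → g ∈ admS T S j → R (j + 1) = 0 → 0 ≤ b j g ∧ Integrable (T.eterm ρ₀ j g) (μ j))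
    (hbook : ∀ j g, j < K → g ∈ admS T S j → R (j + 1) ≠ 0 →
      Integrable (fun y => exp (δ * ((R (j + 1)).map fun w => F j w y).sum) * T.eterm ρ₀ j g y) (μ j) ∧
        ∫ y, exp (δ * ((R (j + 1)).map fun w => F j w y).sum) * T.eterm ρ₀ j g y ∂μ j ≤
          exp (b j g) * ∫ y, T.eterm ρ₀ j g y ∂μ j) :
    LocCondStability T S K μ ρ₀ (fun j _ y => exp (δ * ((R (j + 1)).map fun w => F j w y).sum)) b := by
  intro j g hj hg
  by_cases hR : R (j + 1) = 0
  · obtain ⟨hb, hint⟩ := hfree j g hj hg hR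
    have e : (fun y => exp (δ * ((R (j + 1)).map fun w => F j w y).sum) * T.eterm ρ₀ j g y) = T.eterm ρ₀ j g := by
      funext y
      rw [hR, Multiset.map_zero, Multiset.sum_zero, mul_zero, exp_zero, one_mul]
    refine ⟨by rw [e]; exact hint, ?_⟩
    rw [show (∫ y, exp (δ * ((R (j + 1)).map fun w => F j w y).sum) * T.eterm ρ₀ j g y ∂μ j) =
        ∫ y, T.eterm ρ₀ j g y ∂μ j from by rw [e]]
    exact le_mul_of_one_le_left (integral_eterm_nonneg T μ hρ h0 j g) (one_le_exp hb)
  · exact hbook j g hj hg hR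

/-- The same for a `Finset`-valued booked family (the carrier of `…_of_reading`). [folklore] -/
theorem locCondStability_of_booking_levels' {P : Type} [DecidableEq P] {C : ℕ → Type} {𝒢 : (j : ℕ) → GoodClass (C j)}
    (T : Tower P C 𝒢) (S : (j : ℕ) → (Fin j → P) → Finset P) (K : ℕ) [∀ j, MeasurableSpace (C j)]
    (μ : (j : ℕ) → Measure (C j)) {ρ₀ : C 0 → ℝ} (hρ : (𝒢 0).Gd ρ₀) (h0 : ∀ x, 0 ≤ ρ₀ x) {V : Type*}
    (R : ℕ → Finset V) (F : (j : ℕ) → V → C j → ℝ) (δ : ℝ) (b : (j : ℕ) → (Fin j → P) → ℝ)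
    (hfree : ∀ j g, j < K → g ∈ admS T S j → R (j + 1) = ∅ → 0 ≤ b j g ∧ Integrable (T.eterm ρ₀ j g) (μ j))
    (hbook : ∀ j g, j < K → g ∈ admS T S j → R (j + 1) ≠ ∅ →
      Integrable (fun y => exp (δ * ∑ w ∈ R (j + 1), F j w y) * T.eterm ρ₀ j g y) (μ j) ∧
        ∫ y, exp (δ * ∑ w ∈ R (j + 1), F j w y) * T.eterm ρ₀ j g y ∂μ j ≤ exp (b j g) * ∫ y, T.eterm ρ₀ j g y ∂μ j) :
    LocCondStability T S K μ ρ₀ (fun j _ y => exp (δ * ∑ w ∈ R (j + 1), F j w y)) b := by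
  intro j g hj hg
  by_cases hR : R (j + 1) = ∅
  · obtain ⟨hb, hint⟩ := hfree j g hj hg hR
    have e : (fun y => exp (δ * ∑ w ∈ R (j + 1), F j w y) * T.eterm ρ₀ j g y) = T.eterm ρ₀ j g := by
      funext y
      rw [hR, Finset.sum_empty, mul_zero, exp_zero, one_mul]
    refine ⟨by rw [e]; exact hint, ?_⟩
    rw [show (∫ y, exp (δ * ∑ w ∈ R (j + 1), F j w y) * T.eterm ρ₀ j g y ∂μ j) = ∫ y, T.eterm ρ₀ j g y ∂μ j from by rw [e]]
    exact le_mul_of_one_le_left (integral_eterm_nonneg T μ hρ h0 j g) (one_le_exp hb)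
  · exact hbook j g hj hg hR

end Extraction

/-! ## §4 Run B: pointwise extraction along `keyPatternB` (the class pattern, at cutoff `K + 1`, of the terms truncating into the fibre) -/

section RunB

variable {P : Type} [DecidableEq P] {d : ℕ} (𝒮 : StepReading P d) {C : ℕ → ℕ → Type} {𝒢 : (K j : ℕ) → GoodClass (C K j)}
  (T : (K : ℕ) → Tower P (C K) (𝒢 K)) (p₀ : ℕ → ℕ → P) {ω : Type*} [DecidableEq ω]
  (kmem : ℕ → HIndex.Idx (skelFam T p₀) → ω) (trunc : ℕ → HIndex.Idx (skelFam T p₀) → HIndex.Idx (skelFam T p₀))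

/-- **RUN B's ROW `pwB` IN SHAPE: POINTWISE EXTRACTION ALONG `keyPatternB … trunc K k` ON THE CUTOFF-`(K+1)` TOWER** from (d1) `hle1`, (d2)
`hsupp` on the cutoff-`(K+1)` step kernel (regions `𝒮.ν (K + 1) j g p`, read through `v (j+1)`) and (d3B) `hRB` — the value family
`R (j + 1)` is realised at level `j + 1` by the run of EVERY cutoff-`(K+1)` term truncating into the fibre of `k` (a DISPLAY for run B:
the «TRUNC» reading; the key of the truncation does not book run B's regions by itself). [folklore] -/
theorem pointwiseExtraction_keyPatternB_of_reading {V : Type*} [DecidableEq V] (v : ℕ → Lab d → V) (K : ℕ) (k : ω)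
    (χ : (j : ℕ) → (Fin j → P) → P → C (K + 1) j → ℝ) (F : (j : ℕ) → V → C (K + 1) j → ℝ) (θ : ℕ → V → ℝ) {δ : ℝ}
    (hδ : 0 ≤ δ) (R : ℕ → Finset V)
    (hRB : ∀ j, j < K + 1 → ∀ τ' ∈ filterB T p₀ kmem trunc K k,
      R (j + 1) ⊆ (((𝒮.reading T p₀).inputOf.run (K + 1) τ').N (j + 1)).image (v (j + 1)))
    (hle1 : ∀ j g, j < K + 1 → g ∈ admS (T (K + 1)) (keyPatternB T p₀ kmem trunc K k) j → ∀ y,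
      ∑ p ∈ (T (K + 1)).branch j g ∩ keyPatternB T p₀ kmem trunc K k j g, χ j g p y ≤ 1)
    (hsupp : ∀ j g p, j < K + 1 → g ∈ (T (K + 1)).adm j → p ∈ (T (K + 1)).branch j g → ∀ y, χ j g p y ≠ 0 →
      ∀ Z ∈ 𝒮.ν (K + 1) j g p, θ j (v (j + 1) Z) ≤ F j (v (j + 1) Z) y) :
    PointwiseExtraction (T (K + 1)) (keyPatternB T p₀ kmem trunc K k) (K + 1) χ
      (fun j _ y => exp (δ * ∑ w ∈ R (j + 1), F j w y)) fun j _ => δ * ∑ w ∈ R (j + 1), θ j w :=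
  pointwiseExtraction_classPattern_of_reading 𝒮 T p₀ v (K + 1) (filterB T p₀ kmem trunc K k) χ F θ hδ R hRB hle1 hsupp

/-- **… FROM POSITIVITY AND THE DECOMPOSITION OF UNITY ON THE CUTOFF-`(K+1)` TOWER.** [folklore] -/
theorem pointwiseExtraction_keyPatternB_of_unit {V : Type*} [DecidableEq V] (v : ℕ → Lab d → V) (K : ℕ) (k : ω)
    (χ : (j : ℕ) → (Fin j → P) → P → C (K + 1) j → ℝ) (F : (j : ℕ) → V → C (K + 1) j → ℝ) (θ : ℕ → V → ℝ) {δ : ℝ}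
    (hδ : 0 ≤ δ) (R : ℕ → Finset V)
    (hRB : ∀ j, j < K + 1 → ∀ τ' ∈ filterB T p₀ kmem trunc K k,
      R (j + 1) ⊆ (((𝒮.reading T p₀).inputOf.run (K + 1) τ').N (j + 1)).image (v (j + 1)))
    (hχ0 : ∀ j g p, j < K + 1 → g ∈ (T (K + 1)).adm j → p ∈ (T (K + 1)).branch j g → ∀ y, 0 ≤ χ j g p y)
    (hunit : ∀ j g, j < K + 1 → g ∈ (T (K + 1)).adm j → ∀ y, ∑ p ∈ (T (K + 1)).branch j g, χ j g p y = 1)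
    (hsupp : ∀ j g p, j < K + 1 → g ∈ (T (K + 1)).adm j → p ∈ (T (K + 1)).branch j g → ∀ y, χ j g p y ≠ 0 →
      ∀ Z ∈ 𝒮.ν (K + 1) j g p, θ j (v (j + 1) Z) ≤ F j (v (j + 1) Z) y) :
    PointwiseExtraction (T (K + 1)) (keyPatternB T p₀ kmem trunc K k) (K + 1) χ
      (fun j _ y => exp (δ * ∑ w ∈ R (j + 1), F j w y)) fun j _ => δ * ∑ w ∈ R (j + 1), θ j w :=
  pointwiseExtraction_classPattern_of_unit 𝒮 T p₀ v (K + 1) (filterB T p₀ kmem trunc K k) χ F θ hδ R hRB hχ0 hunit hsupp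

/-- **RUN B WITH MULTIPLICITY** (`R (j + 1)` a multiset of values; only its support displayed as realised, (d3B)). [folklore] -/
theorem pointwiseExtraction_keyPatternB_of_readingM {V : Type*} [DecidableEq V] (v : ℕ → Lab d → V) (K : ℕ) (k : ω)
    (χ : (j : ℕ) → (Fin j → P) → P → C (K + 1) j → ℝ) (F : (j : ℕ) → V → C (K + 1) j → ℝ) (θ : ℕ → V → ℝ) {δ : ℝ}
    (hδ : 0 ≤ δ) (R : ℕ → Multiset V)
    (hRB : ∀ j, j < K + 1 → ∀ τ' ∈ filterB T p₀ kmem trunc K k, ∀ w ∈ R (j + 1),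
      w ∈ (((𝒮.reading T p₀).inputOf.run (K + 1) τ').N (j + 1)).image (v (j + 1)))
    (hle1 : ∀ j g, j < K + 1 → g ∈ admS (T (K + 1)) (keyPatternB T p₀ kmem trunc K k) j → ∀ y,
      ∑ p ∈ (T (K + 1)).branch j g ∩ keyPatternB T p₀ kmem trunc K k j g, χ j g p y ≤ 1)
    (hsupp : ∀ j g p, j < K + 1 → g ∈ (T (K + 1)).adm j → p ∈ (T (K + 1)).branch j g → ∀ y, χ j g p y ≠ 0 →
      ∀ Z ∈ 𝒮.ν (K + 1) j g p, θ j (v (j + 1) Z) ≤ F j (v (j + 1) Z) y) :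
    PointwiseExtraction (T (K + 1)) (keyPatternB T p₀ kmem trunc K k) (K + 1) χ
      (fun j _ y => exp (δ * ((R (j + 1)).map fun w => F j w y).sum)) fun j _ => δ * ((R (j + 1)).map (θ j)).sum :=
  pointwiseExtraction_classPattern_of_readingM 𝒮 T p₀ v (K + 1) (filterB T p₀ kmem trunc K k) χ F θ hδ R hRB hle1 hsupp

/-- **RUN A's ROW ALONG `keyPattern` IS THE CLASS-PATTERN THEOREM AT `Φ := fibre kmem … K k`** (`keyPattern_eq_classPattern`, `rfl`) —
the bridge by which `KeyPatternBooking.pointwiseExtraction_keyPattern_of_reading` and §3 agree BY NAME. [folklore] -/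
theorem pointwiseExtraction_keyPattern_eq_classPattern (K : ℕ) (k : ω) (χ : (j : ℕ) → (Fin j → P) → P → C K j → ℝ)
    (M : (j : ℕ) → (Fin j → P) → C K j → ℝ) (a : (j : ℕ) → (Fin j → P) → ℝ) :
    PointwiseExtraction (T K) (keyPattern T p₀ kmem K k) K χ M a ↔
      PointwiseExtraction (T K) (classPattern T p₀ K (fibre kmem (HIndex.termSet (skelFam T p₀)) K k)) K χ M a :=
  Iff.rfl

end RunB

end

end Summit.QuantumFields.BalabanUV.T4Continuum.NE7b.ClassPatternBooking
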